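import Summits.CriticalPhenomena.PercolationContinuityZ3.Theorems.Transplant.GrigorchukInvertedOrbits
import Summits.CriticalPhenomena.PercolationContinuityZ3.Theorems.Transplant.GrigorchukGrowthRecursion
import Mathlib.Analysis.SpecialFunctions.Pow.Real
import HarnessLib

/-!
# SUBLINEAR INVERTED-ORBIT GROWTH of the first Grigorchuk group: `δ(w) ≤ 5·|w|^α` for an absolute `α < 1`, and the DEPTH lemma
# (a word of length `≤ 2^m` moves `ρ = 1^∞` only in its first `m + 1` letters)

builds on p205010 (kernel theorem, internal audit signed; external expert review pending) — nothing in this file uses p205010; pure group theory / counting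
and elementary real analysis, no percolation statement, no node touched.  Lane `prim-bschramm`, seat `prim-bschramm-gen-1` gen 9 (GEN pen; offer O-BE file F-BE2,
lead g26 GO 2026-08-28T09:30Z).  DEF-FREE helper file (`--supports stmt-CriticalPhenomena-4575 --as helper`): no definition, no instance, no notation; REUSES F-BE1
«GrigorchukInvertedOrbits» (`io`, `dlt`, `track`, `prered`, the splitting `dlt_le_tracks`, the contraction `lw_tracks_le`, the invariances `dlt_prered` /
`evalPerm_prered` / `evalPerm_rho`), G1 «GrigorchukWeightedLength» p609360 (`wordLW`) and G2 «GrigorchukGrowthRecursion» p610208 (`wordLW_le`) — nothing restated.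
NO growth exponent of any GROUP is typed or claimed here: the real number `α = log 2 / log(32/13)` below is a proof constant bounding the size of inverted orbits
(Bartholdi–Erschler's Prop. 4.4 / Cor. 4.8 upper half, with the lane's `η = 13/16` in place of their `η ≈ 0.811`); nothing about the growth of `𝔊` or of
`ℤ ≀_X 𝔊` is concluded in this file (that is F-BE3), nothing about amenability, `θ(p_c)`, or any `@[conjecture]`.

* §1 ONE STEP (packages of F-BE1): `dlt w ≤ dlt u + dlt v` with `16(‖u‖ + ‖v‖) ≤ 13(‖w‖ + 3000)` for the two tracks `u, v` of the pre-reduction of `w`;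
  `w(ρ) = s·u(ρ)` with `2|u| ≤ |w| + 1`.
* §2 THE `k`-LEVEL ITERATE (B–E Prop. 4.4 iterated, the trivial bound `δ ≤ #a + 1` at the leaves instead of their concave majorant Lemma 4.3):
  the `2^k` level-`k` words `levels k w` (an explicit `List.flatMap` iterate, no definition) satisfy `dlt w ≤ Σ dlt`, `16^k·Σ‖·‖ ≤ 13^k‖w‖ + 2100·32^k`, whence
  **`dlt_iterate : 3000·16^k·δ(w) ≤ 13^k·‖w‖ + 5100·32^k`** for every `k`.
* §3 THE POWER BOUND: choosing `k = ⌊log|w| / log(32/13)⌋` gives **`exists_dlt_le_rpow : ∃ α, 0 < α ∧ α < 1 ∧ ∀ w ≠ [], δ(w) ≤ 5·|w|^α`**.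
* §4 THE DEPTH LEMMA: **`apply_eq_true_of_mem_io : |w| ≤ 2^m → x ∈ io w → ∀ i ≥ m + 1, x i = true`** (halving through §1's second package).
[cite: BartholdiErschler2012, Prop. 4.4, Lemma 4.3, Cor. 4.8 (upper bound)] [cite: Bartholdi1998, Prop. (η-contraction)]
-/

noncomputable section

namespace Summit.CriticalPhenomena.PercolationContinuityZ3.Theorems.Transplant
namespace Grigorchuk

open scoped Classical

/-! ## §1 One step: the two tracks of the pre-reduction -/

/-- **ONE STEP OF THE RAREFACTION**: `δ(w) ≤ δ(u) + δ(v)` for the tracks `u, v` of the pre-reduction of `w`. [cite: BartholdiErschler2012, proof of Prop. 4.4] -/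
theorem dlt_le_step (w : List Letter) : dlt w ≤ dlt (track false (prered w)) + dlt (track true (prered w)) := by
  rw [← dlt_prered]; exact dlt_le_tracks _

/-- … with `16·(‖u‖ + ‖v‖) ≤ 13·(‖w‖ + 3000)`. [cite: BartholdiErschler2012, Lemma 4.2] -/
theorem lw_step_le (w : List Letter) : 16 * (wordLW (track false (prered w)) + wordLW (track true (prered w))) ≤ 13 * (wordLW w + 3000) := by
  have h := lw_tracks_le (prered w) false (preRed_prered w)
  rw [Bool.not_false] at h
  exact h.trans (Nat.mul_le_mul_left 13 (Nat.add_le_add_right (wordLW_prered_le w) 3000))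

/-- **ONE STEP OF THE DEPTH RECURSION**: `w(ρ) = s·u(ρ)` for a word `u` with `2|u| ≤ |w| + 1` (a track of the pre-reduction).
[cite: BartholdiErschler2012, §4 (the sections of a pre-reduced word of length n have length ≤ (n+1)/2)] -/
theorem depth_step (w : List Letter) : ∃ (s : Bool) (u : List Letter), evalPerm w rho = cons s (evalPerm u rho) ∧ 2 * u.length ≤ w.length + 1 := by
  refine ⟨!apar (prered w), track (!apar (prered w)) (prered w), ?_, ?_⟩
  · rw [← evalPerm_prered]; exact evalPerm_rho _
  · have h1 := length_track_le (prered w) (!apar (prered w))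
    have h2 := two_nT_le (prered w) (preRed_prered w)
    have h3 := length_prered_le w
    omega

/-! ## §2 The `k`-level iterate -/

/-- The level-`k` words of `w`: iterate "replace each word by the two tracks of its pre-reduction" `k` times (an explicit list; `2^k` words). [cite: BartholdiErschler2012, proof of Prop. 4.4 (iterating the wreath recursion)] -/
theorem length_levels (w : List Letter) : ∀ k : ℕ,
    (Nat.rec [w] (fun _ L => L.flatMap fun u => [track false (prered u), track true (prered u)]) k : List (List Letter)).length = 2 ^ k
  | 0 => rfl
  | k + 1 => by
    simp only [List.length_flatMap, List.length_cons, List.length_nil, List.map_const', List.sum_replicate, smul_eq_mul]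
    rw [length_levels w k, pow_succ]

/-- **`δ(w) ≤ Σ_{level-k words} δ`.** [cite: BartholdiErschler2012, proof of Prop. 4.4] -/
theorem dlt_le_levels_sum (w : List Letter) : ∀ k : ℕ,
    dlt w ≤ ((Nat.rec [w] (fun _ L => L.flatMap fun u => [track false (prered u), track true (prered u)]) k : List (List Letter)).map dlt).sum
  | 0 => by simp
  | k + 1 => by
    refine (dlt_le_levels_sum w k).trans ?_
    simp only
    generalize (Nat.rec [w] (fun _ L => L.flatMap fun u => [track false (prered u), track true (prered u)]) k : List (List Letter)) = L
    induction L with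
    | nil => simp
    | cons u L ih =>
      simp only [List.flatMap_cons, List.map_append, List.sum_append, List.map_cons, List.sum_cons, List.map_nil, List.sum_nil, add_zero] at ih ⊢
      have := dlt_le_step u; omega

/-- **`16^k · Σ_{level-k words} ‖·‖ ≤ 13^k·‖w‖ + 2100·32^k`.** [cite: BartholdiErschler2012, Lemma 4.2 (iterated)] -/
theorem lw_levels_sum_le (w : List Letter) : ∀ k : ℕ,
    16 ^ k * ((Nat.rec [w] (fun _ L => L.flatMap fun u => [track false (prered u), track true (prered u)]) k : List (List Letter)).map wordLW).sum ≤
      13 ^ k * wordLW w + 2100 * 32 ^ k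
  | 0 => by simp
  | k + 1 => by
    have ih := lw_levels_sum_le w k
    have hlen := length_levels w k
    simp only at ih hlen ⊢
    generalize (Nat.rec [w] (fun _ L => L.flatMap fun u => [track false (prered u), track true (prered u)]) k : List (List Letter)) = L at ih hlen ⊢
    -- one step on every word of the level: `16·Σ' ≤ 13·Σ + 39000·|L|`
    have hstep : 16 * ((L.flatMap fun u => [track false (prered u), track true (prered u)]).map wordLW).sum ≤ 13 * (L.map wordLW).sum + 39000 * L.length := by
      clear ih hlen
      induction L with
      | nil => simp
      | cons u L ihL =>
        simp only [List.flatMap_cons, List.map_append, List.sum_append, List.map_cons, List.sum_cons, List.map_nil, List.sum_nil, add_zero, List.length_cons]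
        have := lw_step_le u
        nlinarith [this, ihL]
    rw [hlen] at hstep
    -- `16^(k+1) Σ' = 16^k (16 Σ') ≤ 16^k (13 Σ + 39000·2^k) ≤ 13 (13^k W + 2100·32^k) + 39000·32^k ≤ 13^(k+1) W + 2100·32^(k+1)`
    have e32 : (32 : ℕ) ^ k = 16 ^ k * 2 ^ k := by rw [← mul_pow]; norm_num
    have e66 : 66300 * 32 ^ k ≤ 2100 * 32 ^ (k + 1) := by rw [pow_succ]; omega
    calc 16 ^ (k + 1) * ((L.flatMap fun u => [track false (prered u), track true (prered u)]).map wordLW).sum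
        = 16 ^ k * (16 * ((L.flatMap fun u => [track false (prered u), track true (prered u)]).map wordLW).sum) := by ring
      _ ≤ 16 ^ k * (13 * (L.map wordLW).sum + 39000 * 2 ^ k) := Nat.mul_le_mul_left _ hstep
      _ = 13 * (16 ^ k * (L.map wordLW).sum) + 39000 * 32 ^ k := by rw [e32]; ring
      _ ≤ 13 * (13 ^ k * wordLW w + 2100 * 32 ^ k) + 39000 * 32 ^ k := by omega
      _ = 13 ^ (k + 1) * wordLW w + 66300 * 32 ^ k := by ring
      _ ≤ 13 ^ (k + 1) * wordLW w + 2100 * 32 ^ (k + 1) := Nat.add_le_add_left e66 _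

/-- **THE `k`-LEVEL ITERATE: `3000·16^k·δ(w) ≤ 13^k·‖w‖ + 5100·32^k` for every `k`** (the leaves bounded by `δ(u) ≤ #a(u) + 1 ≤ ‖u‖/3000 + 1`).
[cite: BartholdiErschler2012, Prop. 4.4 (iterated)] -/
theorem dlt_iterate (w : List Letter) (k : ℕ) : 3000 * 16 ^ k * dlt w ≤ 13 ^ k * wordLW w + 5100 * 32 ^ k := by
  have h1 := dlt_le_levels_sum w k
  have h2 := lw_levels_sum_le w k
  have hlen := length_levels w k
  generalize (Nat.rec [w] (fun _ L => L.flatMap fun u => [track false (prered u), track true (prered u)]) k : List (List Letter)) = L at h1 h2 hlen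
  -- leaves: `3000·Σ δ ≤ Σ ‖·‖ + 3000·|L|`
  have hleaf : 3000 * (L.map dlt).sum ≤ (L.map wordLW).sum + 3000 * L.length := by
    clear h1 h2 hlen
    induction L with
    | nil => simp
    | cons u L ih =>
      simp only [List.map_cons, List.sum_cons, List.length_cons]
      have := dlt_le_nA_succ u; have := nA_le_wordLW u
      nlinarith [ih]
  rw [hlen] at hleaf
  have e32 : (32 : ℕ) ^ k = 16 ^ k * 2 ^ k := by rw [← mul_pow]; norm_num
  calc 3000 * 16 ^ k * dlt w ≤ 3000 * 16 ^ k * (L.map dlt).sum := Nat.mul_le_mul_left _ h1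
    _ = 16 ^ k * (3000 * (L.map dlt).sum) := by ring
    _ ≤ 16 ^ k * ((L.map wordLW).sum + 3000 * 2 ^ k) := Nat.mul_le_mul_left _ hleaf
    _ = 16 ^ k * (L.map wordLW).sum + 3000 * 32 ^ k := by rw [e32]; ring
    _ ≤ 13 ^ k * wordLW w + 5100 * 32 ^ k := by omega

/-! ## §3 The power bound -/

/-- **SUBLINEAR INVERTED-ORBIT GROWTH: `δ(w) ≤ 5·|w|^α` for an absolute constant `0 < α < 1`** (`α = log 2 / log(32/13) ≈ 0.77`; choose `k` with
`(32/13)^k ≤ |w| < (32/13)^{k+1}` in `dlt_iterate`, so that `2^k ≤ |w|^α` and `(13/16)^k |w| < (32/13)·2^k`).  A bound on ORBIT sizes — no growth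
exponent of any group. [cite: BartholdiErschler2012, Prop. 4.4 and Cor. 4.8 (δ(w) ≤ C₁ ℓ^α)] -/
theorem exists_dlt_le_rpow : ∃ α : ℝ, 0 < α ∧ α < 1 ∧ ∀ w : List Letter, w ≠ [] → (dlt w : ℝ) ≤ 5 * (w.length : ℝ) ^ α := by
  set b : ℝ := 32 / 13 with hb
  have hb1 : 1 < b := by rw [hb]; norm_num
  have hb0 : 0 < b := by linarith
  have hlog2 : 0 < Real.log 2 := Real.log_pos (by norm_num)
  have hlogb : Real.log 2 < Real.log b := Real.log_lt_log (by norm_num) (by rw [hb]; norm_num)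
  have hlogb0 : 0 < Real.log b := hlog2.trans hlogb
  set α : ℝ := Real.log 2 / Real.log b with hα
  have hα0 : 0 < α := div_pos hlog2 hlogb0
  have hα1 : α < 1 := (div_lt_one hlogb0).2 hlogb
  have hαb : α * Real.log b = Real.log 2 := div_mul_cancel₀ _ hlogb0.ne'
  refine ⟨α, hα0, hα1, fun w hw => ?_⟩
  set n : ℕ := w.length with hn
  have hn1 : 1 ≤ n := by rw [hn]; exact List.length_pos_iff.2 hw
  have hnR : (1 : ℝ) ≤ n := by exact_mod_cast hn1
  have hnpos : (0 : ℝ) < n := by linarith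
  -- the level `k = ⌊log n / log b⌋`
  set L : ℝ := Real.log n / Real.log b with hL
  have hL0 : 0 ≤ L := div_nonneg (Real.log_nonneg hnR) hlogb0.le
  set k : ℕ := ⌊L⌋₊ with hk
  have hkL : (k : ℝ) ≤ L := Nat.floor_le hL0
  have hLk : L < k + 1 := Nat.lt_floor_add_one L
  -- `n < b^(k+1)` and `2^k ≤ n^α`
  have hnb : (n : ℝ) < b ^ (k + 1) := by
    have e1 : (n : ℝ) = Real.exp (L * Real.log b) := by rw [hL, div_mul_cancel₀ _ hlogb0.ne', Real.exp_log hnpos]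
    have e2 : (b : ℝ) ^ (k + 1) = Real.exp (((k : ℝ) + 1) * Real.log b) := by
      rw [← Real.exp_log (pow_pos hb0 (k + 1)), Real.log_pow]; push_cast; ring_nf
    rw [e1, e2, Real.exp_lt_exp]
    exact mul_lt_mul_of_pos_right hLk hlogb0
  have h2k : (2 : ℝ) ^ k ≤ (n : ℝ) ^ α := by
    have e1 : (2 : ℝ) ^ k = Real.exp ((k : ℝ) * Real.log 2) := by
      rw [← Real.exp_log (pow_pos (by norm_num : (0:ℝ) < 2) k), Real.log_pow]
    have e2 : (n : ℝ) ^ α = Real.exp (L * Real.log 2) := by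
      rw [Real.rpow_def_of_pos hnpos, hL, ← hαb]; congr 1; field_simp
    rw [e1, e2, Real.exp_le_exp]
    exact mul_le_mul_of_nonneg_right hkL hlog2.le
  -- the iterate at level `k`, in `ℝ`
  have hit : (3000 : ℝ) * 16 ^ k * dlt w ≤ 13 ^ k * wordLW w + 5100 * 32 ^ k := by exact_mod_cast dlt_iterate w k
  have hW : (wordLW w : ℝ) ≤ 3400 * n := by rw [hn]; exact_mod_cast wordLW_le w
  have h13 : (0 : ℝ) < 13 ^ k := pow_pos (by norm_num) k
  have h16 : (0 : ℝ) < 16 ^ k := pow_pos (by norm_num) k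
  have e32 : (32 : ℝ) ^ k = 16 ^ k * 2 ^ k := by rw [← mul_pow]; norm_num
  have ebk : (13 : ℝ) ^ k * b ^ (k + 1) = 32 / 13 * 32 ^ k := by
    rw [pow_succ, hb, ← mul_assoc, ← mul_pow]; norm_num; ring
  -- `13^k ‖w‖ ≤ 13^k · 3400 n < 3400 · (32/13) · 32^k`
  have hmain : (13 : ℝ) ^ k * wordLW w < 8400 * 32 ^ k := by
    calc (13 : ℝ) ^ k * wordLW w ≤ 13 ^ k * (3400 * n) := mul_le_mul_of_nonneg_left hW h13.le
      _ < 13 ^ k * (3400 * b ^ (k + 1)) := mul_lt_mul_of_pos_left (mul_lt_mul_of_pos_left hnb (by norm_num)) h13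
      _ = 3400 * (32 / 13) * 32 ^ k := by rw [← mul_assoc, mul_comm ((13:ℝ) ^ k) 3400, mul_assoc, ebk]; ring
      _ ≤ 8400 * 32 ^ k := by nlinarith [pow_pos (by norm_num : (0:ℝ) < 32) k]
  -- hence `3000·16^k·δ < 15000·32^k = 3000·16^k·(5·2^k)`, i.e. `δ < 5·2^k ≤ 5·n^α`
  have hlt : (dlt w : ℝ) < 5 * 2 ^ k := by
    have : (3000 : ℝ) * 16 ^ k * dlt w < 3000 * 16 ^ k * (5 * 2 ^ k) := by
      calc (3000 : ℝ) * 16 ^ k * dlt w ≤ 13 ^ k * wordLW w + 5100 * 32 ^ k := hit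
        _ < 8400 * 32 ^ k + 5100 * 32 ^ k := by linarith
        _ ≤ 15000 * 32 ^ k := by nlinarith [pow_pos (by norm_num : (0:ℝ) < 32) k]
        _ = 3000 * 16 ^ k * (5 * 2 ^ k) := by rw [e32]; ring
    exact lt_of_mul_lt_mul_left this (by positivity)
  linarith [mul_le_mul_of_nonneg_left h2k (by norm_num : (0:ℝ) ≤ 5)]

/-! ## §4 The depth lemma -/

/-- A single letter moves `ρ` only in coordinate `0`. [cite: Grigorchuk1980, definition of a, b, c, d] -/
theorem letter_rho_apply (x : Letter) {i : ℕ} (hi : 1 ≤ i) : x.toPerm rho i = true := by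
  rcases x with _ | v
  · show genA rho i = true
    rw [genA_apply, flipAt_apply_ne (by omega)]; rfl
  · rw [show (Letter.x v).toPerm = v.toPerm from rfl, bcd_rho]; rfl

/-- **THE DEPTH LEMMA: a word of length `≤ 2^m` moves `ρ = 1^∞` only in its first `m + 1` coordinates.** [cite: BartholdiErschler2012, §4 (sections halve the length)] -/
theorem evalPerm_rho_apply_eq_true : ∀ (m : ℕ) (w : List Letter), w.length ≤ 2 ^ m → ∀ i : ℕ, m + 1 ≤ i → evalPerm w rho i = true
  | 0, [], _, i, _ => rfl
  | 0, [x], _, i, hi => by rw [evalPerm_cons, evalPerm_nil, mul_one]; exact letter_rho_apply x hi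
  | 0, _ :: _ :: _, h, _, _ => by simp at h
  | m + 1, w, h, i, hi => by
    obtain ⟨s, u, hu, hlen⟩ := depth_step w
    have hu' : u.length ≤ 2 ^ m := by rw [pow_succ] at h; omega
    obtain ⟨j, rfl⟩ : ∃ j, i = j + 1 := ⟨i - 1, by omega⟩
    rw [hu, cons_succ]
    exact evalPerm_rho_apply_eq_true m u hu' j (by omega)

/-- **Every point of the inverted orbit of a word of length `≤ 2^m` agrees with `ρ` beyond coordinate `m`.** [cite: BartholdiErschler2012, §4] -/
theorem apply_eq_true_of_mem_io {m : ℕ} {w : List Letter} (hw : w.length ≤ 2 ^ m) {x : Ray} (hx : x ∈ io w) {i : ℕ} (hi : m + 1 ≤ i) : x i = true := by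
  obtain ⟨j, rfl⟩ := exists_take_of_mem_io w hx
  exact evalPerm_rho_apply_eq_true m _ (by rw [List.length_take]; exact (min_le_right _ _).trans hw) i hi

end Grigorchuk
end Summit.CriticalPhenomena.PercolationContinuityZ3.Theorems.Transplant
end
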